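import Literature.Geometry.Riemannian.WassersteinW1Prokhorov
import Literature.Geometry.Riemannian.WassersteinW1Triangle
import Mathlib.MeasureTheory.Measure.Support
import Mathlib.MeasureTheory.Measure.Portmanteau
import HarnessLib

/-!
# The limit kernels of an `𝔽`-limit are supported on the limit slices
# (Bamler 2023, §5.4, Lemma 5.20, Claim 5.21 — support part)

R. Bamler, *Compactness theory of the space of super Ricci flows*, Invent. Math. 233 (2023), §5.4,
proof of Lemma 5.20 (arXiv v1 Lemma 121: a Cauchy sequence of metric flow pairs within a
correspondence has a limit), Claim 5.21 (arXiv v1 Claim 122): *"For every `s, t ∈ I ∖ E^∞`,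
`s ≤ t` and `x^∞ ∈ X^∞_t` and every sequence `xⁱ ∈ 𝒳ⁱ_t` with `φⁱ_t(xⁱ) → x^∞` we have
`(φⁱ_s)_* νⁱ_{xⁱ;s} → ν^∞_{x^∞;s}` in `W₁`, for some probability measure
`ν^∞_{x^∞;s} ∈ 𝒫(Z_s)` with `supp ν^∞_{x^∞;s} ⊆ X^∞_s`"*, where `X^∞_s := supp μ^∞_s` and
`μ^∞_s` is the `W₁`-limit of `(φⁱ_s)_* μⁱ_s`.

This file proves the SUPPORT statement `supp ν^∞_{x^∞;s} ⊆ supp μ^∞_s`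
(`support_subset_of_kernel_limit`), in abstract form: all metric-flow data are passed explicitly —
comparison spaces `Z_s, Z_t`, time-slices `𝒳ⁱ_s, 𝒳ⁱ_t` with isometric embeddings `φⁱ_s, φⁱ_t`,
the conjugate heat kernels `νⁱ_{·;s}` on `𝒳ⁱ_t` as probability kernels `κ i` that are
`1`-Lipschitz for `d_{W₁}` (Bamler 2023, §3.2, Proposition (c)), the measures `μⁱ_t, μⁱ_s` linked
by the conjugate heat flow identity `μⁱ_s = ∫ νⁱ_{x;s} dμⁱ_t(x)`, their `W₁`-limits `m_t, m_s`,
a point `x ∈ supp m_t` with approximants `φⁱ_t(xⁱ) → x`, and the `W₁`-limit `ν^∞` of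
`(φⁱ_s)_* νⁱ_{xⁱ;s}`.

The proof is the printed one, phrased with `[0, ∞]`-valued integrals: if `y ∈ supp ν^∞` had a
ball `B(y, r)` of `m_s`-measure zero, the `1`-Lipschitz function `f := (r − d(·, y))_+` would
satisfy `∫ f dν^∞ > 0`, hence `∫ f ∘ φⁱ_s dνⁱ_{xⁱ;s} > 2a > 0` for large `i` (`W₁ → 0`); since
`z ↦ ∫ f ∘ φⁱ_s dνⁱ_{z;s}` is `1`-Lipschitz it is `≥ a` on `B(xⁱ, a)`, so
`∫ f ∘ φⁱ_s dμⁱ_s = ∫∫ f ∘ φⁱ_s dνⁱ_{z;s} dμⁱ_t(z) ≥ a μⁱ_t(B(xⁱ, a))`, and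
`μⁱ_t(B(xⁱ, a)) ≥ ((φⁱ_t)_* μⁱ_t)(B(x, a/2))` for large `i`, whose limit inferior is
`≥ m_t(B(x, a/2)) > 0` (portmanteau, `x ∈ supp m_t`) — contradicting
`∫ f ∘ φⁱ_s dμⁱ_s ≤ ∫ f dm_s + d_{W₁}((φⁱ_s)_* μⁱ_s, m_s) = d_{W₁}((φⁱ_s)_* μⁱ_s, m_s) → 0`.

## References

* R. H. Bamler, *Compactness theory of the space of super Ricci flows*, Invent. Math. 233 (2023),
  1121–1277 (arXiv:2008.09298), §5.4, Lemma 5.20 and Claim 5.21 in its proof (arXiv v1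
  Lemma 121, Claim 122); §3.2, Proposition (comparing conjugate heat flows) (c). [Bamler2023]
-/

noncomputable section

open Set MeasureTheory Filter TopologicalSpace Function
open scoped Topology ENNReal NNReal

namespace Literature.Geometry.Riemannian

universe u

/-- **The easy half of Kantorovich–Rubinstein, `[0, ∞]`-valued form**: for measures `μ, ν` on a
metric space and a measurable `F : X → [0, ∞]` with `F a ≤ F b + d(a, b)`,
`∫ F dμ ≤ ∫ F dν + d_{W₁}(μ, ν)` — for every coupling `q`,
`∫ F dμ = ∫ F(p₁) dq ≤ ∫ (F(p₂) + d(p₁, p₂)) dq = ∫ F dν + ∫ d dq`. [folklore] -/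
private theorem lintegral_le_lintegral_add_wassersteinW1 {X : Type u} [MetricSpace X]
    [MeasurableSpace X] (μ ν : Measure X) {F : X → ℝ≥0∞} (hFm : Measurable F)
    (hF : ∀ a b, F a ≤ F b + edist a b) :
    ∫⁻ z, F z ∂μ ≤ ∫⁻ z, F z ∂ν + wassersteinW1 μ ν := by
  rw [wassersteinW1, ENNReal.add_iInf]
  refine le_iInf fun q ↦ ?_
  obtain ⟨q, -, hq1, hq2⟩ := q
  calc ∫⁻ z, F z ∂μ = ∫⁻ p, F p.1 ∂q := by
        rw [← hq1, Measure.fst, lintegral_map hFm measurable_fst]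
    _ ≤ ∫⁻ p, F p.2 + edist p.1 p.2 ∂q := lintegral_mono fun p ↦ hF p.1 p.2
    _ = ∫⁻ p, F p.2 ∂q + ∫⁻ p, edist p.1 p.2 ∂q := lintegral_add_left (hFm.comp measurable_snd) _
    _ = ∫⁻ z, F z ∂ν + ∫⁻ p, edist p.1 p.2 ∂q := by
        rw [← hq2, Measure.snd, lintegral_map hFm measurable_snd]

/-- **Bamler 2023, Claim 5.21 (arXiv v1 Claim 122), support part**: in the setting of the proof
of Lemma 5.20 — isometric embeddings `φⁱ_s : 𝒳ⁱ_s → Z_s`, `φⁱ_t : 𝒳ⁱ_t → Z_t`, conjugate heat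
kernels `νⁱ_{·;s}` on `𝒳ⁱ_t` (probability kernels `κ i`, `1`-Lipschitz for `d_{W₁}`), measures
`μⁱ_s = ∫ νⁱ_{x;s} dμⁱ_t(x)`, `W₁`-limits `m_t` of `(φⁱ_t)_* μⁱ_t` and `m_s` of
`(φⁱ_s)_* μⁱ_s` — if `x ∈ supp m_t`, `φⁱ_t(xⁱ) → x` and `(φⁱ_s)_* νⁱ_{xⁱ;s} → ν^∞` in `W₁`, then
**`supp ν^∞ ⊆ supp m_s = X^∞_s`**.
[cite: Bamler2023, §5.4, Lemma 5.20, Claim 5.21 (arXiv v1 Claim 122)] -/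
theorem support_subset_of_kernel_limit
    {Zs Zt : Type u} [MetricSpace Zs] [MeasurableSpace Zs] [BorelSpace Zs]
    [SecondCountableTopology Zs] [MetricSpace Zt] [MeasurableSpace Zt] [BorelSpace Zt]
    [SecondCountableTopology Zt]
    {Xs Xt : ℕ → Type u} [∀ n, MetricSpace (Xs n)] [∀ n, MeasurableSpace (Xs n)]
    [∀ n, BorelSpace (Xs n)] [∀ n, SecondCountableTopology (Xs n)]
    [∀ n, MetricSpace (Xt n)] [∀ n, MeasurableSpace (Xt n)] [∀ n, BorelSpace (Xt n)]
    [∀ n, SecondCountableTopology (Xt n)]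
    (φs : ∀ n, Xs n → Zs) (φt : ∀ n, Xt n → Zt) (hφs : ∀ n, Isometry (φs n))
    (hφt : ∀ n, Isometry (φt n))
    -- conjugate heat kernels `ν^n_{·;s}` on `𝒳^n_t`, `W₁`-`1`-Lipschitz in the base point
    (κ : ∀ n, Xt n → Measure (Xs n)) [∀ n x, IsProbabilityMeasure (κ n x)]
    (hκ : ∀ n (x y : Xt n), wassersteinW1 (κ n x) (κ n y) ≤ edist x y)
    -- the measures `μ^n_t`, `μ^n_s = ∫ ν^n_{x;s} dμ^n_t(x)` and their `W₁`-limits in `Z_t`, `Z_s`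
    (μt : ∀ n, Measure (Xt n)) (μs : ∀ n, Measure (Xs n)) [∀ n, IsProbabilityMeasure (μt n)]
    [∀ n, IsProbabilityMeasure (μs n)]
    (hchf : ∀ n (f : Xs n → ℝ≥0∞), Measurable f →
      ∫⁻ y, f y ∂μs n = ∫⁻ x, ∫⁻ y, f y ∂κ n x ∂μt n)
    (mt : Measure Zt) (ms : Measure Zs) [IsProbabilityMeasure mt] [IsProbabilityMeasure ms]
    (hmt : Tendsto (fun n ↦ wassersteinW1 ((μt n).map (φt n)) mt) atTop (𝓝 0))
    (hms : Tendsto (fun n ↦ wassersteinW1 ((μs n).map (φs n)) ms) atTop (𝓝 0))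
    -- a point of `supp m_t`, approximants, and the `W₁`-limit of the kernels based at them
    {x : Zt} (hx : x ∈ mt.support) (xn : ∀ n, Xt n)
    (hxn : Tendsto (fun n ↦ φt n (xn n)) atTop (𝓝 x))
    (νinf : Measure Zs) [IsProbabilityMeasure νinf]
    (hν : Tendsto (fun n ↦ wassersteinW1 ((κ n (xn n)).map (φs n)) νinf) atTop (𝓝 0)) :
    νinf.support ⊆ ms.support := by
  intro y hy
  by_contra hy'
  -- a ball `B(y, r)` of `m_s`-measure zero
  obtain ⟨r, hr, hr0⟩ := (Metric.nhds_basis_ball.notMem_measureSupport).1 hy'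
  -- the test function `f = (r - d(·, y))_+`, valued in `[0, ∞]`: measurable, `1`-Lipschitz
  obtain ⟨F, hF_def⟩ : ∃ F : Zs → ℝ≥0∞, F = fun z ↦ ENNReal.ofReal (r - dist z y) := ⟨_, rfl⟩
  have hFm : Measurable F := by
    rw [hF_def]
    exact (ENNReal.continuous_ofReal.comp
      (continuous_const.sub (continuous_id.dist continuous_const))).measurable
  have hF : ∀ a b, F a ≤ F b + edist a b := fun a b ↦ by
    rw [hF_def, edist_dist]
    calc ENNReal.ofReal (r - dist a y) ≤ ENNReal.ofReal ((r - dist b y) + dist a b) :=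
          ENNReal.ofReal_le_ofReal (by linarith [dist_triangle_left b y a])
      _ ≤ ENNReal.ofReal (r - dist b y) + ENNReal.ofReal (dist a b) := ENNReal.ofReal_add_le
  have hFφ : ∀ n (z z' : Xs n), F (φs n z) ≤ F (φs n z') + edist z z' := fun n z z' ↦
    (hF _ _).trans_eq (by rw [(hφs n).edist_eq])
  have hFφm : ∀ n, Measurable fun w ↦ F (φs n w) := fun n ↦
    hFm.comp (hφs n).continuous.measurable
  -- (iv) `∫ f dm_s = 0`
  have hFms : ∫⁻ z, F z ∂ms = 0 := by
    have hae : ∀ᵐ z ∂ms, F z = 0 := by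
      rw [ae_iff]
      refine measure_mono_null (fun z hz ↦ Metric.mem_ball.2 (not_le.1 fun h ↦ hz ?_)) hr0
      rw [hF_def]
      exact ENNReal.ofReal_eq_zero.2 (by linarith)
    exact (lintegral_congr_ae hae).trans lintegral_zero
  -- (i) `c := ∫ f dν^∞ ∈ (0, ∞)`; `b := c / 2`, `a := b / 2`
  obtain ⟨c, hc⟩ : ∃ c, c = ∫⁻ z, F z ∂νinf := ⟨_, rfl⟩
  have hc0 : c ≠ 0 := by
    rw [hc]
    refine ((lintegral_pos_iff_support hFm).2 ?_).ne'
    refine ((Measure.mem_support_iff_forall y).1 hy _ (Metric.ball_mem_nhds y hr)).trans_le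
      (measure_mono fun z hz ↦ ?_)
    rw [Function.mem_support, hF_def]
    exact (ENNReal.ofReal_pos.2 (by linarith [Metric.mem_ball.1 hz])).ne'
  have hctop : c ≠ ∞ := by
    rw [hc]
    refine (lt_of_le_of_lt ?_ (ENNReal.ofReal_lt_top (r := r))).ne
    calc ∫⁻ z, F z ∂νinf ≤ ∫⁻ _, ENNReal.ofReal r ∂νinf := lintegral_mono fun z ↦ by
          rw [hF_def]
          exact ENNReal.ofReal_le_ofReal (by linarith [dist_nonneg (x := z) (y := y)])
      _ = ENNReal.ofReal r := by rw [lintegral_const, measure_univ, mul_one]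
  obtain ⟨b, hb⟩ : ∃ b, b = c / 2 := ⟨_, rfl⟩
  have hb0 : b ≠ 0 := hb ▸ (ENNReal.half_pos hc0).ne'
  have hbtop : b ≠ ∞ := hb ▸ (ENNReal.div_lt_top hctop two_ne_zero).ne
  have hbb : b + b = c := by rw [hb, ENNReal.add_halves]
  obtain ⟨a, ha⟩ : ∃ a, a = b / 2 := ⟨_, rfl⟩
  have ha0 : a ≠ 0 := ha ▸ (ENNReal.half_pos hb0).ne'
  have haa : a + a = b := by rw [ha, ENNReal.add_halves]
  have ha2 : 0 < a / 2 := ENNReal.half_pos ha0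
  -- (ii) the functions `G n z := ∫ f ∘ φⁿ_s dνⁿ_{z;s}` are `1`-Lipschitz
  have hG : ∀ n (z z' : Xt n),
      ∫⁻ w, F (φs n w) ∂κ n z ≤ ∫⁻ w, F (φs n w) ∂κ n z' + edist z z' := fun n z z' ↦
    (lintegral_le_lintegral_add_wassersteinW1 (κ n z) (κ n z') (hFφm n) (hFφ n)).trans
      (add_le_add le_rfl (hκ n z z'))
  -- (i) eventually `G n xⁿ > b`
  have hE1 : ∀ᶠ n in atTop, b < ∫⁻ w, F (φs n w) ∂κ n (xn n) := by
    filter_upwards [(tendsto_order.1 hν).2 b (pos_iff_ne_zero.2 hb0)] with n hn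
    have hle : c ≤ ∫⁻ w, F (φs n w) ∂κ n (xn n) +
        wassersteinW1 ((κ n (xn n)).map (φs n)) νinf := by
      rw [hc, ← lintegral_map hFm (hφs n).continuous.measurable, wassersteinW1_comm]
      exact lintegral_le_lintegral_add_wassersteinW1 _ _ hFm hF
    by_contra h
    have h' := not_lt.1 h
    have hlt := ENNReal.add_lt_add_of_le_of_lt (ne_top_of_le_ne_top hbtop h') h' hn
    rw [hbb] at hlt
    exact absurd hle (not_le.2 hlt)
  -- the approximants `φⁿ_t(xⁿ)` are eventually `a/2`-close to `x`
  have hE3 : ∀ᶠ n in atTop, edist (φt n (xn n)) x < a / 2 := EMetric.tendsto_nhds.1 hxn _ ha2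
  -- (iii) portmanteau: `liminf ((φⁿ_t)_* μⁿ_t)(B(x, a/2)) ≥ m_t(B(x, a/2)) > β > 0`
  obtain ⟨B, hB⟩ : ∃ B : Set Zt, B = Metric.eball x (a / 2) := ⟨_, rfl⟩
  have hBo : IsOpen B := hB ▸ Metric.isOpen_eball
  have hB0 : mt B ≠ 0 :=
    ((Measure.mem_support_iff_forall x).1 hx B (hB ▸ Metric.eball_mem_nhds x ha2)).ne'
  obtain ⟨β, hβ⟩ : ∃ β, β = mt B / 2 := ⟨_, rfl⟩
  have hβ0 : β ≠ 0 := hβ ▸ (ENNReal.half_pos hB0).ne'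
  have hβlt : β < mt B := hβ ▸ ENNReal.half_lt_self hB0 (measure_ne_top mt B)
  have hlim : mt B ≤ liminf (fun n ↦ ((μt n).map (φt n)) B) atTop := by
    let P : ℕ → ProbabilityMeasure Zt := fun n ↦
      ⟨(μt n).map (φt n), Measure.isProbabilityMeasure_map (hφt n).continuous.aemeasurable⟩
    have hT : Tendsto P atTop (𝓝 (⟨mt, inferInstance⟩ : ProbabilityMeasure Zt)) :=
      ProbabilityMeasure.tendsto_of_tendsto_wassersteinW1 hmt
    exact ProbabilityMeasure.le_liminf_measure_open_of_tendsto hT hBo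
  have hE4 : ∀ᶠ n in atTop, β < ((μt n).map (φt n)) B :=
    eventually_lt_of_lt_liminf (hβlt.trans_le hlim)
  -- (iv) eventually `d_{W₁}((φⁿ_s)_* μⁿ_s, m_s) < a β`
  have hE5 : ∀ᶠ n in atTop, wassersteinW1 ((μs n).map (φs n)) ms < a * β :=
    (tendsto_order.1 hms).2 _ (ENNReal.mul_pos ha0 hβ0)
  obtain ⟨n, h1, h3, h4, h5⟩ := (hE1.and (hE3.and (hE4.and hE5))).exists
  -- (ii) on `B(xⁿ, a)` we have `G n ≥ a`
  have hGa : ∀ z ∈ Metric.eball (xn n) a, a ≤ ∫⁻ w, F (φs n w) ∂κ n z := by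
    intro z hz
    rw [Metric.mem_eball, edist_comm] at hz
    by_contra h
    have hlt := (hG n (xn n) z).trans_lt (ENNReal.add_lt_add (not_le.1 h) hz)
    rw [haa] at hlt
    exact absurd h1 (not_lt.2 hlt.le)
  -- `(φⁿ_t)⁻¹ B(x, a/2) ⊆ B(xⁿ, a)`
  have hpre : φt n ⁻¹' B ⊆ Metric.eball (xn n) a := by
    intro z hz
    rw [hB, mem_preimage, Metric.mem_eball] at hz
    rw [Metric.mem_eball]
    calc edist z (xn n) = edist (φt n z) (φt n (xn n)) := ((hφt n).edist_eq z (xn n)).symm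
      _ ≤ edist (φt n z) x + edist x (φt n (xn n)) := edist_triangle _ _ _
      _ < a / 2 + a / 2 := ENNReal.add_lt_add hz ((edist_comm _ _).trans_lt h3)
      _ = a := ENNReal.add_halves a
  -- the contradiction `a β ≤ ∫ f ∘ φⁿ_s dμⁿ_s ≤ d_{W₁}((φⁿ_s)_* μⁿ_s, m_s) < a β`
  have hchain : a * β ≤ wassersteinW1 ((μs n).map (φs n)) ms := by
    calc a * β ≤ a * ((μt n).map (φt n)) B := mul_le_mul_right h4.le a
      _ = a * μt n (φt n ⁻¹' B) := by
          rw [Measure.map_apply (hφt n).continuous.measurable hBo.measurableSet]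
      _ ≤ a * μt n (Metric.eball (xn n) a) := mul_le_mul_right (measure_mono hpre) a
      _ = ∫⁻ z, (Metric.eball (xn n) a).indicator (fun _ ↦ a) z ∂μt n :=
          (lintegral_indicator_const Metric.isOpen_eball.measurableSet a).symm
      _ ≤ ∫⁻ z, ∫⁻ w, F (φs n w) ∂κ n z ∂μt n := by
          refine lintegral_mono fun z ↦ ?_
          by_cases hz : z ∈ Metric.eball (xn n) a
          · rw [indicator_of_mem hz]
            exact hGa z hz
          · rw [indicator_of_notMem hz]
            exact zero_le
      _ = ∫⁻ w, F (φs n w) ∂μs n := (hchf n _ (hFφm n)).symm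
      _ = ∫⁻ z, F z ∂(μs n).map (φs n) := (lintegral_map hFm (hφs n).continuous.measurable).symm
      _ ≤ ∫⁻ z, F z ∂ms + wassersteinW1 ((μs n).map (φs n)) ms :=
          lintegral_le_lintegral_add_wassersteinW1 _ _ hFm hF
      _ = wassersteinW1 ((μs n).map (φs n)) ms := by rw [hFms, zero_add]
  exact absurd h5 (not_lt.2 hchain)

end Literature.Geometry.Riemannian

end
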